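import Mathlib
import Summits.Ventures.PercRepro2.IFRTail
import Summits.Ventures.PercRepro2.IFRConv

/-!
# Series–parallel tail calculus is log-concave (seat mine-b, cell pub-perc-repro2)

The max-flow `F` of a two-terminal series–parallel network with independent Bernoulli edges satisfies
`F = min(F₁, F₂)` under series composition and `F = F₁ + F₂` under parallel composition of independent
sub-networks (Menger; proofs/MINE-B-FLOW-IFR-SP.md §3).  Here we formalise the resulting TAIL CALCULUS:
a single edge has tail `(…, 1, 1, p, 0, …)`, series = pointwise product of tails, parallel = `Hsum`
(the convolution tail of `IFRConv.lean`), and we prove by structural induction that every tail so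
obtained is log-concave (`SP.tail_isLCTail`).  This is the series–parallel case of row B2 of
conjectures/MINE-B.md (log-concavity of the max-flow tail), modulo the paper identification of the
flow with the recursion.
-/

open Finset

namespace Summit.Ventures.PercRepro2.IFR

-- `Hsum` is a genuine tail (the sum of the pmf is one, etc.) and it is log-concave.
section HsumTail

variable {F G : ℤ → ℝ} {NF NG M : ℤ}

/-- exact shift identity with boundary terms -/
lemma sum_shift_exact (φ : ℤ → ℝ) (hM0 : 0 ≤ M) :
    ∑ s ∈ I M, φ (s - 1) = ∑ s ∈ I M, φ s + φ (-M - 1) - φ M := by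
  unfold I
  have himg : ∑ s ∈ Finset.Icc (-M) M, φ (s - 1) = ∑ s ∈ Finset.Icc (-M - 1) (M - 1), φ s := by
    refine Finset.sum_nbij' (fun s => s - 1) (fun s => s + 1) ?_ ?_ ?_ ?_ ?_
    · intro x hx; simp only [Finset.mem_Icc] at hx ⊢; omega
    · intro x hx; simp only [Finset.mem_Icc] at hx ⊢; omega
    · intro x _; simp
    · intro x _; simp
    · intro x _; rfl
  rw [himg]
  have e1 : ∑ s ∈ Finset.Icc (-M - 1) (M - 1), φ s = φ (-M - 1) + ∑ s ∈ Finset.Icc (-M) (M - 1), φ s := by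
    have hmem : (-M - 1) ∈ Finset.Icc (-M - 1) (M - 1) := by simp only [Finset.mem_Icc]; omega
    rw [← Finset.add_sum_erase _ _ hmem]
    congr 1
    apply Finset.sum_congr
    · ext x; simp only [Finset.mem_erase, Finset.mem_Icc]; omega
    · intros; rfl
  have e2 : ∑ s ∈ Finset.Icc (-M) M, φ s = φ M + ∑ s ∈ Finset.Icc (-M) (M - 1), φ s := by
    have hmem : M ∈ Finset.Icc (-M) M := by simp only [Finset.mem_Icc]; omega
    rw [← Finset.add_sum_erase _ _ hmem]
    congr 1
    apply Finset.sum_congr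
    · ext x; simp only [Finset.mem_erase, Finset.mem_Icc]; omega
    · intros; rfl
  rw [e1, e2]; ring

variable (hF : IsLCTail F NF) (hG : IsLCTail G NG)

include hG in
/-- the pmf sums to one over any interval containing the support -/
lemma sum_pmf_eq_one (hM : NG ≤ M + 1) (hM0 : 0 ≤ M) : ∑ s ∈ I M, IsLCTail.pmf G s = 1 := by
  have h := sum_shift_exact (M := M) (fun s => G (s + 1)) hM0
  have e : ∀ s, IsLCTail.pmf G s = G s - G (s + 1) := fun s => rfl
  simp only [e]
  rw [Finset.sum_sub_distrib]
  have h' : ∑ s ∈ I M, G (s - 1 + 1) = ∑ s ∈ I M, G s :=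
    Finset.sum_congr rfl (fun s _ => by rw [sub_add_cancel])
  rw [h'] at h
  rw [h, hG.one (-M - 1 + 1) (by omega), hG.vanish (M + 1) hM]; ring

include hF hG in
/-- `Hsum` is a log-concave tail with support bound `NF + NG`. -/
theorem Hsum_isLCTail (hM : NG + 1 ≤ M) (hM0 : 0 ≤ M) :
    IsLCTail (Hsum F G M) (NF + NG) where
  one := by
    intro k hk
    unfold Hsum
    have : ∀ s ∈ I M, IsLCTail.pmf G s * F (k - s) = IsLCTail.pmf G s := by
      intro s _
      by_cases hs : s ≤ -1
      · rw [pmf_vanish_neg hG hs]; ring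
      · rw [hF.one (k - s) (by omega)]; ring
    rw [Finset.sum_congr rfl this]
    exact sum_pmf_eq_one hG (by omega) hM0
  nonneg := by
    intro k; unfold Hsum
    exact Finset.sum_nonneg (fun s _ => mul_nonneg (hG.pmf_nonneg s) (hF.nonneg _))
  anti := by
    intro k; unfold Hsum
    apply Finset.sum_le_sum; intro s _
    apply mul_le_mul_of_nonneg_left _ (hG.pmf_nonneg s)
    have e : k + 1 - s = k - s + 1 := by ring
    rw [e]; exact hF.anti (k - s)
  lc := fun k => Hsum_logconcave hF hG hM hM0 k
  vanish := by
    intro k hk; unfold Hsum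
    apply Finset.sum_eq_zero; intro s _
    by_cases hs : NG ≤ s
    · rw [pmf_vanish_top hG hs]; ring
    · rw [hF.vanish (k - s) (by omega)]; ring

end HsumTail

section Product

variable {F G : ℤ → ℝ} {NF NG : ℤ} (hF : IsLCTail F NF) (hG : IsLCTail G NG)

include hF hG in
/-- the pointwise product of two log-concave tails is a log-concave tail (series composition = minimum) -/
theorem mul_isLCTail : IsLCTail (fun k => F k * G k) (min NF NG) where
  one := by intro k hk; show F k * G k = 1; rw [hF.one k hk, hG.one k hk]; ring
  nonneg := fun k => mul_nonneg (hF.nonneg k) (hG.nonneg k)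
  anti := fun k => mul_le_mul (hF.anti k) (hG.anti k) (hG.nonneg _) (hF.nonneg _)
  lc := by
    intro k
    show F (k - 1) * G (k - 1) * (F (k + 1) * G (k + 1)) ≤ F k * G k * (F k * G k)
    have h1 := hF.lc k; have h2 := hG.lc k
    have := mul_le_mul h1 h2 (mul_nonneg (hG.nonneg _) (hG.nonneg _)) (mul_nonneg (hF.nonneg _) (hF.nonneg _))
    calc F (k - 1) * G (k - 1) * (F (k + 1) * G (k + 1))
        = F (k - 1) * F (k + 1) * (G (k - 1) * G (k + 1)) := by ring
      _ ≤ F k * F k * (G k * G k) := this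
      _ = F k * G k * (F k * G k) := by ring
  vanish := by
    intro k hk
    show F k * G k = 0
    rcases le_total NF NG with h | h
    · rw [min_eq_left h] at hk; rw [hF.vanish k hk]; ring
    · rw [min_eq_right h] at hk; rw [hG.vanish k hk]; ring

end Product

section SeriesParallel

/-- two-terminal series–parallel networks with independent Bernoulli edges (only the edge probabilities matter) -/
inductive SP : Type
  | edge (p : ℝ) (h0 : 0 ≤ p) (h1 : p ≤ 1) : SP
  | series (a b : SP) : SP
  | parallel (a b : SP) : SP

/-- the tail of a single edge: `(…, 1, 1, p, 0, …)` -/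
noncomputable def edgeTail (p : ℝ) (k : ℤ) : ℝ := if k ≤ 0 then 1 else if k = 1 then p else 0

/-- the single-edge tail is log-concave -/
theorem edgeTail_isLCTail {p : ℝ} (h0 : 0 ≤ p) (h1 : p ≤ 1) : IsLCTail (edgeTail p) 2 where
  one := by intro k hk; unfold edgeTail; simp [hk]
  nonneg := by
    intro k; unfold edgeTail
    split_ifs <;> linarith
  anti := by
    intro k; unfold edgeTail
    split_ifs <;> linarith
  lc := by
    intro k; unfold edgeTail
    split_ifs <;> nlinarith
  vanish := by
    intro k hk; unfold edgeTail
    have h2 : ¬ k ≤ 0 := by omega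
    have h3 : ¬ k = 1 := by omega
    simp [h2, h3]

/-- support bound of the tail of a network -/
def SP.bound : SP → ℤ
  | .edge _ _ _ => 2
  | .series a b => min a.bound b.bound
  | .parallel a b => a.bound + b.bound

/-- the bound is positive -/
theorem SP.bound_pos : ∀ t : SP, 1 ≤ t.bound
  | .edge _ _ _ => by simp [SP.bound]
  | .series a b => by
      simp only [SP.bound]; have := SP.bound_pos a; have := SP.bound_pos b; omega
  | .parallel a b => by
      simp only [SP.bound]; have := SP.bound_pos a; have := SP.bound_pos b; omega

/-- the tail calculus: edge ↦ `edgeTail`, series ↦ product, parallel ↦ `Hsum` (convolution) -/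
noncomputable def SP.tail : SP → (ℤ → ℝ)
  | .edge p _ _ => edgeTail p
  | .series a b => fun k => a.tail k * b.tail k
  | .parallel a b => Hsum a.tail b.tail (b.bound + 1)

/-- **Series–parallel tails are log-concave**: the tail calculus of any two-terminal series–parallel network
with independent Bernoulli edges produces a log-concave (IFR) tail. -/
theorem SP.tail_isLCTail : ∀ t : SP, IsLCTail t.tail t.bound
  | .edge p h0 h1 => edgeTail_isLCTail h0 h1
  | .series a b => by
      simp only [SP.tail, SP.bound]
      exact mul_isLCTail (SP.tail_isLCTail a) (SP.tail_isLCTail b)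
  | .parallel a b => by
      simp only [SP.tail, SP.bound]
      have hb := SP.bound_pos b
      exact Hsum_isLCTail (SP.tail_isLCTail a) (SP.tail_isLCTail b) le_rfl (by omega)

/-- the headline inequality for series–parallel networks: `P(F ≥ k−1)·P(F ≥ k+1) ≤ P(F ≥ k)²` -/
theorem SP.tail_logconcave (t : SP) (k : ℤ) :
    t.tail (k - 1) * t.tail (k + 1) ≤ t.tail k * t.tail k :=
  (SP.tail_isLCTail t).lc k

end SeriesParallel

end Summit.Ventures.PercRepro2.IFR
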